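import Literature.Computability.AlgebraicComplexity.MS21SigmaPiOrbitsProofs
import Mathlib.RingTheory.MvPolynomial.Homogeneous
import HarnessLib

/-!
# Medini–Shpilka 2021, §5.2: homogenisation under uniform maps with an INERT extra coordinate
# (lem:uniIndGenHitsHom both ways; PRINT-ERRATA B34, repair step 1)

Support file (cell `val-lit`, seat p1 g5) for the `MS2021_thm_35` programme (owner x5 g3) and the
record PRINT-ERRATA B34 (lit g7, 2026-08-27). Source: [MediniShpilka2021] CCC 2021 = arXiv:2102.05632,
§5.2 unnumbered ‹lem:uniIndGenHitsHom› (held text p0027:L22–L30) and its two uses, p0030:L30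
(proof of Thm 35, equal-depth case: "where we extend `G` to `n+1` coordinates such that `G` is still
a uniform `k`-independent map") and p0036:L10 (proof of Thm 45).

## What is printed, what is the gap, what is proved here

* Printed lemma: "Let `f ∈ F[x]` have degree `d`, `g(x_0, x) = x_0^d f(x/x_0)` its homogenization,
  `G : F^t → F^{n+1}` a polynomial map whose coordinates are homogeneous of identical degree, `H`
  its restriction to the coordinates `[n]`. If `g ∘ G ≠ 0` then `f ∘ H ≠ 0`." — PROVED here for an
  arbitrary homogenising variable `o` and re-embedding `ι` of the variables
  (`MS2021.bind₁_ne_zero_of_bind₁_homogenization_ne_zero`, common degree `e ≥ 1`; for `e = 0` it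
  fails: `f = x_1 - 1`, `G = (c, 1)`).
* B34 (record-class, lit registry): the printed USE needs a uniform `k`-INDEPENDENT `G'` into
  `F^{n+1}` restricting to the given `G`; for a map that is uniform in the typed = printed sense
  (Def 19: the SUM over the blocks is homogeneous) but whose blocks admit no killing assignment,
  no such `G'` exists (kernel evidence: cell file `np/evidence/p1g5-MS21UniformNotBlockwise.lean`).
* Repair, step 1 (this file): use the INERT extension `G⁺ = (G_0, …, G_{n-1}, u^e)` with ONE fresh
  variable `u` — it is uniform but deliberately NOT independent in the new coordinate — and prove
  the transfer in BOTH directions: `f ∘ G ≠ 0 ↔ g_d(f) ∘ G⁺ ≠ 0`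
  (`MS2021.bind₁_ne_zero_iff_inert_homogenization`; `→` by setting `u := 1`, `←` = the printed lemma).
  For orbit elements: with the bordered matrix `Ã = [[A, b], [0, 1]] ∈ GL_{n+1}` (`MS2021.borderMatrix`,
  `det Ã = det A`), the degree-`d` homogenisation of `g(Ax + b)` for HOMOGENEOUS `g` of degree `d`
  (`ANF_Δ`, `T_{s,d}`) is `g(Ãx̃)` (`MS2021.homogenization_affSubst_eq`, via the rehomogenisation
  identity `MS2021.homogenization_aeval_lastCases_eq_self`), so it lies in the LINEAR orbit
  `g^{GL_{n+1}}` (`MS2021.homogenization_mem_linOrbit_of_mem_affOrbit`), and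
  `g(Ax+b) ∘ G ≠ 0 ↔ g(Ãx̃) ∘ G⁺ ≠ 0` (`MS2021.bind₁_affSubst_ne_zero_iff_borderMatrix`).
  Step 2 (not here): the downstream Lemmas 3.9/3.10/5.13–5.15 only ever use block assignments at
  coordinates in `[n]` (dual vectors to the rows of `Ã` can be chosen with `v_n = 0` since their
  `x`-parts are the rows of `A`), so they apply to `G⁺`, which is `k`-independent RELATIVE TO `[n]`
  (cell memo `np/p1g5-B34-repair-memo.md`).

Rendering: homogenising variable `x_n = Fin.last n`, old variables along `Fin.castSucc` (compatible
with `MS2021.affSubst`'s `Fin.castLE`); `g_d(f) = ∑_{i ≤ d} x_n^{d-i} · f^{[i]}(x_{castSucc})` with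
Mathlib's `homogeneousComponent` (the general lemmas allow any `o`, `ι`); dehomogenisation
`ρ = Fin.lastCases 1 X`; `G⁺ = Fin.lastCases (X (inr ()) ^ e) (rename inl ∘ G)` on variables
`τ ⊕ Unit`; `∘` is `bind₁`. One definition (`borderMatrix`, with `@[simp]` entry lemmas), no named
facts. HONEST FRAMING: plumbing for a literature discharge and an erratum record; `VP ≠ VNP` is NOT
proved and nothing here bears on it.

## References
* [MediniShpilka2021] D. Medini, A. Shpilka, CCC 2021 (LIPIcs 200:19) = arXiv:2102.05632: §5.2
  ‹lem:uniIndGenHitsHom› (p0027:L22-L30), proof of Thm 35 (p0027:L20, p0030:L28-L33), proof of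
  Thm 45 (p0036:L9-L10); Def 19 (`k`-independent / uniform, p0006:L64-L67); §1.1.6 eq. (2).
-/

noncomputable section

open MvPolynomial

namespace Literature.Computability.AlgebraicComplexity

namespace MS2021

/-! ### Rehomogenisation: a homogeneous polynomial is the homogenisation of its dehomogenisation -/

section Rehomogenize

variable {K : Type*} [Field K] {n : ℕ}

/-- Dehomogenising a monomial at `x_last := 1`: `ρ(c·x̃^m) = c · ∏_{j<n} x_j^{m_j}`. [folklore] -/
private theorem aeval_lastCases_monomial (m : Fin (n + 1) →₀ ℕ) (c : K) :
    aeval (Fin.lastCases (motive := fun _ => MvPolynomial (Fin n) K) 1 X) (monomial m c) =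
      C c * ∏ j : Fin n, X j ^ m (Fin.castSucc j) := by
  rw [aeval_monomial, algebraMap_eq, Finsupp.prod_pow, Fin.prod_univ_castSucc]
  simp only [Fin.lastCases_castSucc, Fin.lastCases_last, one_pow, mul_one]

/-- The monomial `∏_{j<n} x_j^{m_j}` is homogeneous of degree `∑_j m_j`. [folklore] -/
private theorem isHomogeneous_prod_X_pow (e : Fin n → ℕ) :
    (∏ j : Fin n, X j ^ e j : MvPolynomial (Fin n) K).IsHomogeneous (∑ j, e j) :=
  IsHomogeneous.prod _ _ _ fun _ _ => isHomogeneous_X_pow _ _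

/-- **Rehomogenisation**: a homogeneous `P ∈ K[x_0, …, x_n]` of degree `d` equals the degree-`d`
homogenisation (in `x_n = Fin.last n`) of its dehomogenisation `P(x, 1)`:
`P = ∑_{i ≤ d} x_n^{d-i} · (P(x,1))^{[i]}(x_{castSucc})` — the algebra behind "let `g(x_0, x) =
x_0^d f(x/x_0)` be the homogenization of `f`". [cite: MediniShpilka2021, lem:uniIndGenHitsHom (arXiv p0027:L22-L24)] -/
theorem homogenization_aeval_lastCases_eq_self {d : ℕ} (P : MvPolynomial (Fin (n + 1)) K)
    (hP : P.IsHomogeneous d) :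
    (∑ i ∈ Finset.range (d + 1), X (Fin.last n) ^ (d - i) *
      rename Fin.castSucc (homogeneousComponent i
        (aeval (Fin.lastCases (motive := fun _ => MvPolynomial (Fin n) K) 1 X) P))) = P := by
  classical
  -- expand `P` into monomials and push the (linear) operations through
  conv_rhs => rw [P.as_sum]
  conv_lhs => rw [P.as_sum]
  simp only [map_sum, Finset.mul_sum]
  rw [Finset.sum_comm]
  refine Finset.sum_congr rfl fun m hm => ?_
  -- one monomial `c · x̃^m` with `|m| = d`
  have hdeg : ∑ v, m v = d := by
    have h := hP (mem_support_iff.1 hm)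
    rw [Finsupp.weight_apply, Finsupp.sum_fintype _ _ (fun _ => by simp)] at h
    simpa using h
  rw [Fin.sum_univ_castSucc] at hdeg
  set D := ∑ j : Fin n, m (Fin.castSucc j) with hD
  have hDle : D ≤ d := by omega
  have hlast : d - D = m (Fin.last n) := by omega
  have hhom : (C (coeff m P) * ∏ j : Fin n, X j ^ m (Fin.castSucc j) :
      MvPolynomial (Fin n) K) ∈ homogeneousSubmodule (Fin n) K D :=
    (mem_homogeneousSubmodule _ _).2 ((isHomogeneous_prod_X_pow _).C_mul _)
  simp_rw [aeval_lastCases_monomial, homogeneousComponent_of_mem hhom]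
  simp_rw [apply_ite (rename Fin.castSucc), map_zero, mul_ite, mul_zero]
  rw [Finset.sum_ite_eq', if_pos (Finset.mem_range.2 (Nat.lt_succ_of_le hDle)), hlast, map_mul,
    rename_C, map_prod]
  simp_rw [map_pow, rename_X]
  rw [monomial_eq, Finsupp.prod_pow, Fin.prod_univ_castSucc]
  ring

/-- Hence dehomogenisation is injective on homogeneous polynomials of a fixed degree (so the
homogenisation of `f` is THE homogeneous polynomial of degree `d` dehomogenising to `f`).
[cite: MediniShpilka2021, lem:uniIndGenHitsHom (arXiv p0027:L22-L24)] -/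
theorem eq_of_isHomogeneous_of_aeval_lastCases_eq {d : ℕ} {P Q : MvPolynomial (Fin (n + 1)) K}
    (hP : P.IsHomogeneous d) (hQ : Q.IsHomogeneous d)
    (h : aeval (Fin.lastCases (motive := fun _ => MvPolynomial (Fin n) K) 1 X) P =
      aeval (Fin.lastCases (motive := fun _ => MvPolynomial (Fin n) K) 1 X) Q) : P = Q := by
  rw [← homogenization_aeval_lastCases_eq_self P hP, ← homogenization_aeval_lastCases_eq_self Q hQ, h]

end Rehomogenize

/-! ### Homogenisation and uniform maps (lem:uniIndGenHitsHom) -/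

section Homogenization

variable {K : Type*} [Field K] {σ σ' τ : Type*}

/-- Under a UNIFORM map of positive degree `e`, the homogeneous components of `f` compose to
homogeneous polynomials of the pairwise distinct degrees `e·k`; hence `f ∘ H = 0` forces every
`f^{[k]} ∘ H = 0` ("for any `i < i'` … we must have `deg(f^{[d-i]} ∘ H) > deg(f^{[d-i']} ∘ H)`. Thus,
nothing can cancel"). [cite: MediniShpilka2021, proof of lem:uniIndGenHitsHom (arXiv p0027:L25-L30)] -/
theorem bind₁_homogeneousComponent_eq_zero_of_uniform (f : MvPolynomial σ K)
    (H : σ → MvPolynomial τ K) {e : ℕ} (he : 1 ≤ e) (hH : ∀ j, (H j).IsHomogeneous e)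
    (h0 : bind₁ H f = 0) (k : ℕ) : bind₁ H (homogeneousComponent k f) = 0 := by
  classical
  by_cases hk : f.totalDegree < k
  · rw [homogeneousComponent_eq_zero k f hk, map_zero]
  push Not at hk
  have hhom : ∀ i, bind₁ H (homogeneousComponent i f) ∈ homogeneousSubmodule τ K (e * i) := by
    intro i
    rw [mem_homogeneousSubmodule, ← aeval_eq_bind₁]
    exact (homogeneousComponent_isHomogeneous i f).aeval H hH
  have hsum : bind₁ H f = ∑ i ∈ Finset.range (f.totalDegree + 1),
      bind₁ H (homogeneousComponent i f) := by
    conv_lhs => rw [← sum_homogeneousComponent (φ := f)]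
    rw [map_sum]
  have hc := congr_arg (homogeneousComponent (e * k)) h0
  rw [hsum, map_sum, map_zero] at hc
  rw [Finset.sum_eq_single k] at hc
  · rwa [homogeneousComponent_of_mem (hhom k), if_pos rfl] at hc
  · intro i _ hik
    rw [homogeneousComponent_of_mem (hhom i), if_neg]
    intro hei
    exact hik (Nat.eq_of_mul_eq_mul_left (by omega) hei).symm
  · intro hkr
    exact absurd (Finset.mem_range.2 (Nat.lt_succ_of_le hk)) hkr

/-- **MS lem:uniIndGenHitsHom (uniform maps and homogenisation).** "Let `f ∈ F[x_1..x_n]` be a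
polynomial of degree `d`. Let `g(x_0, x) = x_0^d f(x_1/x_0, …, x_n/x_0)` be the homogenization of `f`,
and let `G : F^t → F^{n+1}` be a polynomial map such that the coordinates of `G` are homogeneous
polynomials of identical degree. Let `H` be the restriction of `G` to the coordinates in `[n]`. If
`g ∘ G ≠ 0` then `f ∘ H ≠ 0`." Typed for an arbitrary homogenising variable `o : σ'` and an
arbitrary re-embedding `ι : σ → σ'` of the variables of `f` (no hypothesis on `o`, `ι` is needed for
this direction), with `g = ∑_{m ≤ d} x_o^{d-m} · f^{[m]}(x_ι)` for any `d`, `H = G ∘ ι`, and the common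
degree `e ≥ 1` (for `e = 0`, i.e. constant coordinates, the statement fails: `f = x_1 - 1`,
`G = (c, 1)`, `c ≠ 1`). [cite: MediniShpilka2021, lem:uniIndGenHitsHom (arXiv p0027:L22-L30; used in the proofs of Thm 35 §5.2 and Thm 45 §6.3)] -/
theorem bind₁_ne_zero_of_bind₁_homogenization_ne_zero {d : ℕ} (f : MvPolynomial σ K) (o : σ')
    (ι : σ → σ') (G : σ' → MvPolynomial τ K) {e : ℕ} (he : 1 ≤ e)
    (hG : ∀ j, (G j).IsHomogeneous e)
    (h : bind₁ G (∑ i ∈ Finset.range (d + 1),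
      X o ^ (d - i) * rename ι (homogeneousComponent i f)) ≠ 0) :
    bind₁ (fun j => G (ι j)) f ≠ 0 := by
  intro h0
  apply h
  rw [map_sum]
  refine Finset.sum_eq_zero fun i _ => ?_
  rw [map_mul, bind₁_rename]
  have : (G ∘ ι) = fun j => G (ι j) := rfl
  rw [this, bind₁_homogeneousComponent_eq_zero_of_uniform f _ he (fun j => hG _) h0, mul_zero]

/-- The degree-`d` homogenisation `∑_{m ≤ d} x_o^{d-m} f^{[m]}(x_ι)` is homogeneous of degree `d`.
[cite: MediniShpilka2021, lem:uniIndGenHitsHom (arXiv p0027:L22-L24)] -/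
theorem homogenization_isHomogeneous (d : ℕ) (f : MvPolynomial σ K) (o : σ') (ι : σ → σ') :
    (∑ i ∈ Finset.range (d + 1),
      X o ^ (d - i) * rename ι (homogeneousComponent i f) : MvPolynomial σ' K).IsHomogeneous d := by
  refine IsHomogeneous.sum _ _ _ fun i hi => ?_
  have hid : (d - i) + i = d := by
    have := Finset.mem_range.1 hi
    omega
  have hmul := (isHomogeneous_X_pow (o : σ') (d - i)).mul
    ((homogeneousComponent_isHomogeneous i f).rename_isHomogeneous (f := ι))
  rwa [hid] at hmul

/-- Dehomogenisation: substituting `x_o := 1`, `x_{ι j} := x_j` into the degree-`d` homogenisation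
returns `f` (for `d ≥ deg f`). [cite: MediniShpilka2021, lem:uniIndGenHitsHom (arXiv p0027:L22-L24)] -/
theorem aeval_homogenization_eq_self {d : ℕ} (f : MvPolynomial σ K) (hf : f.totalDegree ≤ d)
    (o : σ') (ι : σ → σ') (ρ : σ' → MvPolynomial σ K) (hρo : ρ o = 1) (hρ : ∀ j, ρ (ι j) = X j) :
    aeval ρ (∑ i ∈ Finset.range (d + 1),
        X o ^ (d - i) * rename ι (homogeneousComponent i f) : MvPolynomial σ' K) = f := by
  rw [map_sum]
  have hterm : ∀ i ∈ Finset.range (d + 1), aeval ρ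
      (X o ^ (d - i) * rename ι (homogeneousComponent i f)) = homogeneousComponent i f := by
    intro i _
    rw [map_mul, map_pow, aeval_X, hρo, one_pow, one_mul, aeval_rename]
    have : (ρ ∘ ι) = X := funext fun j => hρ j
    rw [this, aeval_X_left_apply]
  rw [Finset.sum_congr rfl hterm, ← Finset.sum_range_add_sum_Ico _ (Nat.succ_le_succ hf),
    sum_homogeneousComponent, Finset.sum_eq_zero, add_zero]
  intro i hi
  rw [Finset.mem_Ico] at hi
  exact homogeneousComponent_eq_zero i f (by omega)

variable {n : ℕ}

/-- Dehomogenisation with `x_0` as homogenising variable (`ι = Fin.succ`): `g(1, x) = f`.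
[cite: MediniShpilka2021, lem:uniIndGenHitsHom (arXiv p0027:L22-L24)] -/
theorem aeval_homogenization_zero_succ {d : ℕ} (f : MvPolynomial (Fin n) K)
    (hf : f.totalDegree ≤ d) :
    aeval (Fin.cases (1 : MvPolynomial (Fin n) K) X)
      (∑ i ∈ Finset.range (d + 1),
        X 0 ^ (d - i) * rename Fin.succ (homogeneousComponent i f) :
          MvPolynomial (Fin (n + 1)) K) = f :=
  aeval_homogenization_eq_self f hf 0 Fin.succ _ Fin.cases_zero (fun j => Fin.cases_succ j)

/-- Dehomogenisation with `x_n = Fin.last n` as homogenising variable (`ι = Fin.castSucc`, the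
embedding compatible with `MS2021.affSubst`'s `Fin.castLE`): `g(x, 1) = f`.
[cite: MediniShpilka2021, lem:uniIndGenHitsHom (arXiv p0027:L22-L24)] -/
theorem aeval_homogenization_last_castSucc {d : ℕ} (f : MvPolynomial (Fin n) K)
    (hf : f.totalDegree ≤ d) :
    aeval (Fin.lastCases (motive := fun _ => MvPolynomial (Fin n) K) 1 X)
      (∑ i ∈ Finset.range (d + 1),
        X (Fin.last n) ^ (d - i) * rename Fin.castSucc (homogeneousComponent i f) :
          MvPolynomial (Fin (n + 1)) K) = f :=
  aeval_homogenization_eq_self f hf (Fin.last n) Fin.castSucc _ (Fin.lastCases_last)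
    (fun j => Fin.lastCases_castSucc j)

end Homogenization

/-! ### The inert homogenising coordinate: `G⁺ = (G ∘ ι ↦ G, o ↦ u^e)` with a FRESH variable `u` -/

section Inert

variable {K : Type*} [Field K] {σ σ' τ : Type*}

/-- Composition of the homogenisation with a map `G⁺` sending the homogenising variable `o` to
`u^e` (`u` a fresh variable) and `ι j` to `G_j`: `g_d(f) ∘ G⁺ = ∑_i u^{e(d-i)} · (f^{[i]} ∘ G)`.
[cite: MediniShpilka2021, proof of lem:uniIndGenHitsHom (arXiv p0027:L25-L27)] -/
theorem bind₁_inert_homogenization {d e : ℕ} (f : MvPolynomial σ K) (o : σ') (ι : σ → σ')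
    (G : σ → MvPolynomial τ K) (G' : σ' → MvPolynomial (τ ⊕ Unit) K)
    (hGo : G' o = X (Sum.inr ()) ^ e) (hGι : ∀ j, G' (ι j) = rename Sum.inl (G j)) :
    bind₁ G' (∑ i ∈ Finset.range (d + 1), X o ^ (d - i) * rename ι (homogeneousComponent i f)) =
      ∑ i ∈ Finset.range (d + 1), X (Sum.inr ()) ^ (e * (d - i)) *
        rename Sum.inl (bind₁ G (homogeneousComponent i f)) := by
  rw [map_sum]
  refine Finset.sum_congr rfl fun i _ => ?_
  rw [map_mul, map_pow, bind₁_X_right, hGo, ← pow_mul, bind₁_rename]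
  have hfun : (G' ∘ ι) = fun j => rename Sum.inl (G j) := funext hGι
  rw [hfun, ← aeval_eq_bind₁, ← aeval_eq_bind₁, ← AlgHom.comp_apply (rename Sum.inl),
    comp_aeval]

/-- Setting the fresh variable `u := 1` in `g_d(f) ∘ G⁺` returns `f ∘ G` (for `d ≥ deg f`).
[cite: MediniShpilka2021, proof of lem:uniIndGenHitsHom (arXiv p0027:L25-L27)] -/
theorem aeval_one_bind₁_inert_homogenization {d e : ℕ} (f : MvPolynomial σ K)
    (hf : f.totalDegree ≤ d) (o : σ') (ι : σ → σ') (G : σ → MvPolynomial τ K)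
    (G' : σ' → MvPolynomial (τ ⊕ Unit) K)
    (hGo : G' o = X (Sum.inr ()) ^ e) (hGι : ∀ j, G' (ι j) = rename Sum.inl (G j)) :
    aeval (Sum.elim X (fun _ => (1 : MvPolynomial τ K)))
      (bind₁ G' (∑ i ∈ Finset.range (d + 1), X o ^ (d - i) * rename ι (homogeneousComponent i f))) =
      bind₁ G f := by
  rw [bind₁_inert_homogenization f o ι G G' hGo hGι, map_sum]
  have hterm : ∀ i ∈ Finset.range (d + 1), aeval (Sum.elim X (fun _ => (1 : MvPolynomial τ K)))
      (X (Sum.inr ()) ^ (e * (d - i)) * rename Sum.inl (bind₁ G (homogeneousComponent i f))) =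
      bind₁ G (homogeneousComponent i f) := by
    intro i _
    rw [map_mul, map_pow, aeval_X, Sum.elim_inr, one_pow, one_mul, aeval_rename]
    have : ((Sum.elim X (fun _ => (1 : MvPolynomial τ K)) : τ ⊕ Unit → MvPolynomial τ K) ∘
        Sum.inl) = X := rfl
    rw [this, aeval_X_left_apply]
  rw [Finset.sum_congr rfl hterm, ← map_sum, ← Finset.sum_range_add_sum_Ico _ (Nat.succ_le_succ hf),
    sum_homogeneousComponent, Finset.sum_eq_zero, add_zero]
  intro i hi
  rw [Finset.mem_Ico] at hi
  exact homogeneousComponent_eq_zero i f (by omega)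

/-- **Transfer, affine → homogeneous** (the easy direction): if `f ∘ G ≠ 0` then
`g_d(f) ∘ G⁺ ≠ 0` for the inert extension `G⁺`. [cite: MediniShpilka2021, lem:uniIndGenHitsHom (arXiv p0027:L22-L30)] -/
theorem bind₁_inert_homogenization_ne_zero {d e : ℕ} (f : MvPolynomial σ K)
    (hf : f.totalDegree ≤ d) (o : σ') (ι : σ → σ') (G : σ → MvPolynomial τ K)
    (G' : σ' → MvPolynomial (τ ⊕ Unit) K)
    (hGo : G' o = X (Sum.inr ()) ^ e) (hGι : ∀ j, G' (ι j) = rename Sum.inl (G j))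
    (h : bind₁ G f ≠ 0) :
    bind₁ G' (∑ i ∈ Finset.range (d + 1), X o ^ (d - i) * rename ι (homogeneousComponent i f)) ≠ 0 := by
  intro h0
  apply h
  rw [← aeval_one_bind₁_inert_homogenization f hf o ι G G' hGo hGι, h0, map_zero]

variable {n : ℕ}

/-- **The inert extension of a uniform map is uniform and the transfer is an equivalence**
(B34 repair, step 1): for `G : F^n`-valued with all coordinates homogeneous of degree `e ≥ 1` and
`G⁺ = (G_0, …, G_{n-1}, u^e)` on one more variable `u`,
`f ∘ G ≠ 0 ↔ g_d(f) ∘ G⁺ ≠ 0` (`d ≥ deg f`, homogenising variable `x_n = Fin.last n`). `G⁺` is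
NOT required to be independent in the new coordinate (it is not: no block reaches it) — this is
the point of the repair. [cite: MediniShpilka2021, lem:uniIndGenHitsHom (arXiv p0027:L22-L30) and its use p0030:L30] -/
theorem bind₁_ne_zero_iff_inert_homogenization {d e : ℕ} (f : MvPolynomial (Fin n) K)
    (hf : f.totalDegree ≤ d) (G : Fin n → MvPolynomial τ K) (he : 1 ≤ e)
    (hG : ∀ j, (G j).IsHomogeneous e) :
    bind₁ G f ≠ 0 ↔
      bind₁ (Fin.lastCases (motive := fun _ => MvPolynomial (τ ⊕ Unit) K)
          (X (Sum.inr ()) ^ e) (fun j => rename Sum.inl (G j)))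
        (∑ i ∈ Finset.range (d + 1), X (Fin.last n) ^ (d - i) *
          rename Fin.castSucc (homogeneousComponent i f)) ≠ 0 := by
  constructor
  · exact bind₁_inert_homogenization_ne_zero f hf (Fin.last n) Fin.castSucc G _
      (Fin.lastCases_last) (fun j => Fin.lastCases_castSucc j)
  · intro h
    have key := bind₁_ne_zero_of_bind₁_homogenization_ne_zero (d := d) f (Fin.last n) Fin.castSucc
      (Fin.lastCases (motive := fun _ => MvPolynomial (τ ⊕ Unit) K)
        (X (Sum.inr ()) ^ e) (fun j => rename Sum.inl (G j))) he ?_ h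
    · intro h0
      apply key
      have hfun : (fun j => Fin.lastCases (motive := fun _ => MvPolynomial (τ ⊕ Unit) K)
          (X (Sum.inr ()) ^ e) (fun j => rename Sum.inl (G j)) (Fin.castSucc j)) =
          fun j => rename Sum.inl (G j) := funext fun j => Fin.lastCases_castSucc j
      rw [← aeval_eq_bind₁, hfun, ← comp_aeval, AlgHom.comp_apply, aeval_eq_bind₁, h0, map_zero]
    · intro j
      refine Fin.lastCases ?_ (fun j => ?_) j
      · rw [Fin.lastCases_last]
        exact isHomogeneous_X_pow _ _
      · rw [Fin.lastCases_castSucc]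
        exact (hG j).rename_isHomogeneous

end Inert

/-! ### Orbits: the homogenisation of `g(Ax + b)` is `g(Ãx̃)` with the bordered matrix
`Ã = [[A, b], [0, 1]]` (B34 repair, step 1 for `affOrbit`) -/

section Orbit

variable {K : Type*} [Field K] {m n : ℕ}

/-- **The bordered matrix `Ã = [[A, b], [0, 1]]`** of an affine substitution `(A, b)`: rows
`r < n` are `(A_r | b_r)`, the last row is `e_n` — the matrix of the homogenised linear forms
`ℓ̃_{i,j,k} = x_0 · ℓ_{i,j,k}(x/x_0)` of the printed proofs (homogenising variable `x_n = Fin.last n`).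
[cite: MediniShpilka2021, proof of Thm 45 (arXiv p0036:L9-L10) and of Thm 35 (p0027:L20)] -/
def borderMatrix (A : Matrix (Fin n) (Fin n) K) (b : Fin n → K) : Matrix (Fin (n + 1)) (Fin (n + 1)) K :=
  Matrix.of fun i j => Fin.lastCases (motive := fun _ => K)
    (Fin.lastCases (motive := fun _ => K) 1 (fun _ => 0) j)
    (fun r => Fin.lastCases (motive := fun _ => K) (b r) (fun j' => A r j') j) i

/-- Entries of `Ã`: the `A` block. [cite: MediniShpilka2021, proof of Thm 45 (arXiv p0036:L9)] -/
@[simp] theorem borderMatrix_castSucc_castSucc (A : Matrix (Fin n) (Fin n) K) (b : Fin n → K)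
    (r j : Fin n) : borderMatrix A b (Fin.castSucc r) (Fin.castSucc j) = A r j := by
  simp [borderMatrix]

/-- Entries of `Ã`: the `b` column. [cite: MediniShpilka2021, proof of Thm 45 (arXiv p0036:L9)] -/
@[simp] theorem borderMatrix_castSucc_last (A : Matrix (Fin n) (Fin n) K) (b : Fin n → K)
    (r : Fin n) : borderMatrix A b (Fin.castSucc r) (Fin.last n) = b r := by
  simp [borderMatrix]

/-- Entries of `Ã`: the last row is `e_n`. [cite: MediniShpilka2021, proof of Thm 45 (arXiv p0036:L9)] -/
@[simp] theorem borderMatrix_last_castSucc (A : Matrix (Fin n) (Fin n) K) (b : Fin n → K)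
    (j : Fin n) : borderMatrix A b (Fin.last n) (Fin.castSucc j) = 0 := by
  simp [borderMatrix]

/-- Entries of `Ã`: `Ã_{nn} = 1`. [cite: MediniShpilka2021, proof of Thm 45 (arXiv p0036:L9)] -/
@[simp] theorem borderMatrix_last_last (A : Matrix (Fin n) (Fin n) K) (b : Fin n → K) :
    borderMatrix A b (Fin.last n) (Fin.last n) = 1 := by
  simp [borderMatrix]

/-- `det Ã = det A` (expand along the last row). [cite: MediniShpilka2021, proof of Thm 45 (arXiv p0036:L9)] -/
theorem det_borderMatrix (A : Matrix (Fin n) (Fin n) K) (b : Fin n → K) :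
    (borderMatrix A b).det = A.det := by
  rw [Matrix.det_succ_row _ (Fin.last n), Fintype.sum_eq_single (Fin.last n)]
  · rw [borderMatrix_last_last, mul_one]
    have hsign : ((-1 : K) ^ ((Fin.last n : ℕ) + (Fin.last n : ℕ))) = 1 := by
      rw [← two_mul, pow_mul, neg_one_sq, one_pow]
    rw [hsign, one_mul]
    congr 1
    ext r j'
    simp only [Matrix.submatrix_apply, Fin.succAbove_last, borderMatrix_castSucc_castSucc]
  · intro j hj
    obtain ⟨j', rfl⟩ := Fin.exists_castSucc_eq.2 hj
    rw [borderMatrix_last_castSucc, mul_zero, zero_mul]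

/-- `A ∈ GL_n ⇒ Ã ∈ GL_{n+1}`. [cite: MediniShpilka2021, proof of Thm 45 (arXiv p0036:L9)] -/
theorem isUnit_det_borderMatrix {A : Matrix (Fin n) (Fin n) K} (hA : IsUnit A.det) (b : Fin n → K) :
    IsUnit (borderMatrix A b).det := by
  rw [det_borderMatrix]
  exact hA

/-- The rows `r < m ≤ n` of `Ã` give the substitution `y_r ↦ ∑_j A_{rj} x_j + b_r x_n`.
[cite: MediniShpilka2021, §1.1.6 eq. (2) (CCC p.19:9; arXiv p0007:L7-L10)] -/
theorem affSubst_borderMatrix_eq_aeval (h : m ≤ n) (A : Matrix (Fin n) (Fin n) K) (b : Fin n → K)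
    (g : MvPolynomial (Fin m) K) :
    affSubst (h.trans (Nat.le_succ n)) (borderMatrix A b) 0 g =
      aeval (fun r : Fin m => (∑ j : Fin n, C (A (Fin.castLE h r) j) * X (Fin.castSucc j)) +
        C (b (Fin.castLE h r)) * X (Fin.last n)) g := by
  unfold affSubst
  refine congrArg (fun F : Fin m → MvPolynomial (Fin (n + 1)) K => aeval F g) (funext fun r => ?_)
  have hc : Fin.castLE (h.trans (Nat.le_succ n)) r = Fin.castSucc (Fin.castLE h r) :=
    Fin.ext rfl
  rw [hc, Pi.zero_apply, C_0, add_zero, Fin.sum_univ_castSucc]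
  simp only [borderMatrix_castSucc_castSucc, borderMatrix_castSucc_last]

/-- **Homogenisation of an orbit element** (for `g` homogeneous of degree `d`, e.g. `ANF_Δ` with
`d = 2^Δ`, `T_{s,d}`): `g_d(g(Ax + b)) = g(Ãx̃)` — the "`h_i` is the homogenization of `f_i`",
`h_i = ANF_Δ(ℓ̃_1, …)` with `ℓ̃ = x_0 ℓ(x/x_0)`, of the printed proofs.
[cite: MediniShpilka2021, proof of Thm 35 (arXiv p0027:L20, p0030:L30) and of Thm 45 (p0036:L9-L10)] -/
theorem homogenization_affSubst_eq {d : ℕ} (h : m ≤ n) (A : Matrix (Fin n) (Fin n) K)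
    (b : Fin n → K) (g : MvPolynomial (Fin m) K) (hg : g.IsHomogeneous d) :
    (∑ i ∈ Finset.range (d + 1), X (Fin.last n) ^ (d - i) *
        rename Fin.castSucc (homogeneousComponent i (affSubst h A b g))) =
      affSubst (h.trans (Nat.le_succ n)) (borderMatrix A b) 0 g := by
  classical
  have hdeg : (affSubst h A b g).totalDegree ≤ d :=
    (totalDegree_affSubst_le h A b g).trans hg.totalDegree_le
  refine eq_of_isHomogeneous_of_aeval_lastCases_eq (homogenization_isHomogeneous d _ _ _) ?_ ?_
  · -- `g(Ãx̃)` is homogeneous of degree `d`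
    rw [affSubst_borderMatrix_eq_aeval h]
    have key := hg.aeval (fun r : Fin m => (∑ j : Fin n, C (A (Fin.castLE h r) j) *
        X (Fin.castSucc j)) + C (b (Fin.castLE h r)) * X (Fin.last n)) (n := 1) (fun r => ?_)
    · rwa [one_mul] at key
    · refine IsHomogeneous.add (IsHomogeneous.sum _ _ _ fun j _ => ?_) ?_
      · exact (isHomogeneous_X _ _).C_mul _
      · exact (isHomogeneous_X _ _).C_mul _
  · -- both dehomogenise to `g(Ax + b)`
    rw [aeval_homogenization_last_castSucc _ hdeg, affSubst_borderMatrix_eq_aeval h,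
      ← AlgHom.comp_apply, comp_aeval]
    unfold affSubst
    refine congrArg (fun F : Fin m → MvPolynomial (Fin n) K => aeval F g) (funext fun r => ?_)
    simp only [map_add, map_sum, map_mul, aeval_C, aeval_X,
      algebraMap_eq, Fin.lastCases_castSucc, Fin.lastCases_last, mul_one]

/-- The homogenisation of an element of the affine orbit `g^{GLaff_n}` of a homogeneous `g` lies in
the LINEAR orbit `g^{GL_{n+1}}` ("which is a homogeneous polynomial in `T^{GL_{n+1}(F)}`", p0036:L9).
[cite: MediniShpilka2021, proof of Thm 45 (arXiv p0036:L9-L10); §1.1.6 (orbits)] -/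
theorem homogenization_mem_linOrbit_of_mem_affOrbit {d : ℕ} {g : MvPolynomial (Fin m) K}
    (hg : g.IsHomogeneous d) {f : MvPolynomial (Fin n) K} (hf : f ∈ affOrbit n g) :
    (∑ i ∈ Finset.range (d + 1), X (Fin.last n) ^ (d - i) *
        rename Fin.castSucc (homogeneousComponent i f)) ∈ linOrbit (n + 1) g := by
  obtain ⟨h, A, b, hA, rfl⟩ := hf
  exact ⟨h.trans (Nat.le_succ n), _, isUnit_det_borderMatrix hA b,
    homogenization_affSubst_eq h A b g hg⟩

/-- **B34 repair, step 1, packaged for orbits**: for `g` homogeneous of degree `d`,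
`f = g(Ax+b)`, and `G` with all coordinates homogeneous of degree `e ≥ 1`:
`f ∘ G ≠ 0 ↔ g(Ãx̃) ∘ G⁺ ≠ 0`, where `G⁺ = (G, u^e)` is the inert extension (one fresh variable,
NOT independent in the new coordinate) and `Ã = [[A, b], [0, 1]] ∈ GL_{n+1}`.
[cite: MediniShpilka2021, lem:uniIndGenHitsHom and its uses (arXiv p0027:L22-L30, p0030:L30, p0036:L10)] -/
theorem bind₁_affSubst_ne_zero_iff_borderMatrix {d e : ℕ} (h : m ≤ n) (A : Matrix (Fin n) (Fin n) K)
    (b : Fin n → K) {g : MvPolynomial (Fin m) K} (hg : g.IsHomogeneous d) {τ : Type*}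
    (G : Fin n → MvPolynomial τ K) (he : 1 ≤ e) (hG : ∀ j, (G j).IsHomogeneous e) :
    bind₁ G (affSubst h A b g) ≠ 0 ↔
      bind₁ (Fin.lastCases (motive := fun _ => MvPolynomial (τ ⊕ Unit) K)
          (X (Sum.inr ()) ^ e) (fun j => rename Sum.inl (G j)))
        (affSubst (h.trans (Nat.le_succ n)) (borderMatrix A b) 0 g) ≠ 0 := by
  rw [← homogenization_affSubst_eq h A b g hg]
  exact bind₁_ne_zero_iff_inert_homogenization _
    ((totalDegree_affSubst_le h A b g).trans hg.totalDegree_le) G he hG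

end Orbit


end MS2021

end Literature.Computability.AlgebraicComplexity

end
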